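import Mathlib
import Literature.Computability.AlgebraicComplexity.Apolarity
import Literature.Computability.AlgebraicComplexity.ApolarityAction
import Literature.Computability.AlgebraicComplexity.ApolarityTopPairing
import Literature.Computability.AlgebraicComplexity.BorderApolarityMembership
import Literature.Computability.AlgebraicComplexity.OrbitClosure
import Literature.Computability.AlgebraicComplexity.LinSubst
import Summits.ValiantsHypothesis.ValiantsHypothesis.Theorems.BorderApolarityToricFixedPointsToricLimitIsInitialAux1

/-!
# Border apolarity, crux `FixedWitnessObstructionQP` — the SOCLE STEP (line `toric-face-debordering`)

Route `ValiantsHypothesis/BorderApolarity`, crux item `stmt-ValiantsHypothesis-5778`, line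
`toric-face-debordering`, stub `stub_socle`.  If `J` is the border-apolar limit of the TORIC family
`Q_t = u · diag((t+2)^w) · g · det_m` (integer weights `w`; only the limsup clause W3 in degree `m`
is used) and `J_m ⌟ pp = 0` for the padded permanent `pp = X₀₀^{m-n} per_n` (W5 in degree `m`),
then `pp = u · wHC_{w'}^{e'}(g' · det_m)` for some `g' ∈ GL_{m²}`, ℕ-valued weights `w'` and
`e' : ℕ`.

Proof.  With `F = g · det_m = Σ_d F_d x^d` the torus acts diagonally,
`diag(b^w) · F = Σ_d b^{⟨w,d⟩} F_d x^d` (`Socle.linSubst_diagonal_eq_sum`, from the elementary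
torus lemmas `tli_*` of the sibling crux file `…ToricFixedPointsToricLimitIsInitialAux1`), so for
the top weight `e₀ = max ⟨w,d⟩` and the top component `F₀ = Σ_{⟨w,d⟩ = e₀} F_d x^d ≠ 0` one
has `(t+2)^{-e₀} Q_t → u · F₀ =: Q_∞` coefficientwise (`Socle.tendsto_coeffVec_torus`).  Every
degree-`m` form apolar to `Q_∞` is a coefficientwise limit of degree-`m` annihilators of the `Q_t`
(`BorderApolarity.mem_of_sum_eq_zero`, top-degree pairing), hence lies in `J m` by W3
(`Socle.mem_of_apolarAction_limit_eq_zero`); so `Ann_m(Q_∞) ⊆ J m ⊆ Ann_m(pp)`, and two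
hyperplanes of `S_m` in containment have proportional normals
(`Socle.exists_eq_smul_of_apolar_imp`): `pp = μ • u · F₀ = u · wHC_w^{e₀}(μ F)`,
`μ F = g' · det_m` (the orbit of `det` is a cone,
`BorderApolarity.smul_mem_glOrbit_detPoly`), and shifting `w` by its minimum makes the weights
ℕ-valued without changing the component (`F` is a form of degree `m`).
Sources: Buczyńska–Buczyński 2021 Thm 1 (necessity half, socle degree); Landsberg 2017 §6.7.
-/

open MvPolynomial Filter
open scoped BigOperators Matrix Topology
open Literature.Computability.AlgebraicComplexity

namespace Summit.ValiantsHypothesis.ValiantsHypothesis.Theorems.BorderApolarityFixedWitnessObstructionQP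

namespace Socle

noncomputable section

section General

variable {σ : Type*}

/-- Coefficientwise convergence of a finite combination `Σ_i c_t(i) • P_i` of fixed polynomials
with convergent scalar coefficients. [folklore] -/
theorem tendsto_coeffVec_sum_smul {ι : Type*} (s : Finset ι) (P : ι → MvPolynomial σ ℂ)
    {c : ℕ → ι → ℂ} {c₀ : ι → ℂ} (hc : ∀ i ∈ s, Tendsto (fun t => c t i) atTop (𝓝 (c₀ i))) :
    Tendsto (fun t => coeffVec (∑ i ∈ s, c t i • P i)) atTop
      (𝓝 (coeffVec (∑ i ∈ s, c₀ i • P i))) := by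
  rw [tendsto_pi_nhds]
  intro x
  simp only [coeffVec_apply, coeff_sum, coeff_smul, smul_eq_mul]
  exact tendsto_finsetSum s fun i hi => (hc i hi).mul_const _

/-- For integers `k ≤ e`: `(t+2)^{k-e} · c → [k = e] · c` as `t → ∞`. [folklore] -/
theorem tendsto_zpow_sub_mul {k e : ℤ} (hk : k ≤ e) (c : ℂ) :
    Tendsto (fun t : ℕ => ((t : ℂ) + 2) ^ (k - e) * c) atTop (𝓝 (if k = e then c else 0)) := by
  rcases hk.lt_or_eq with hlt | rfl
  · rw [if_neg hlt.ne, ← zero_mul c]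
    exact (BorderApolarityToricFixedPoints.tli_tendsto_zpow_neg tendsto_id
      (sub_neg.2 hlt)).mul_const c
  · simp

end General

section Torus

variable {σ : Type*} [Fintype σ] [DecidableEq σ]

/-- Torus elements act diagonally in the monomial basis:
`diag(a) · F = Σ_{d ∈ supp F} (∏_{i ∈ supp d} a_i^{d_i} · F_d) x^d`. [folklore] -/
theorem linSubst_diagonal_eq_sum (a : σ → ℂ) (F : MvPolynomial σ ℂ) :
    linSubst σ ℂ (Matrix.diagonal a) F =
      ∑ d ∈ F.support, ((∏ i ∈ d.support, a i ^ d i) * coeff d F) • monomial d (1 : ℂ) := by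
  conv_lhs => rw [F.as_sum, map_sum]
  refine Finset.sum_congr rfl fun d _ => ?_
  rw [BorderApolarityToricFixedPoints.tli_linSubst_diagonal_monomial, smul_monomial, smul_eq_mul,
    mul_one, mul_comm]

/-- The rescaled torus translate as a finite combination of fixed polynomials:
`b^{-e₀} • A·(diag(b^w)·F) = Σ_{d ∈ supp F} (b^{⟨w,d⟩ - e₀} F_d) • A·x^d`
(`⟨w,d⟩ = Finsupp.weight w d`). [folklore] -/
theorem smul_linSubst_torus (A : Matrix σ σ ℂ) (F : MvPolynomial σ ℂ) (w : σ → ℤ) (e₀ : ℤ)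
    {b : ℂ} (hb : b ≠ 0) :
    b ^ (-e₀) • linSubst σ ℂ A (linSubst σ ℂ (Matrix.diagonal fun i => b ^ (w i)) F) =
      ∑ d ∈ F.support, (b ^ (Finsupp.weight w d - e₀) * coeff d F) •
        linSubst σ ℂ A (monomial d (1 : ℂ)) := by
  rw [linSubst_diagonal_eq_sum, map_sum, Finset.smul_sum]
  refine Finset.sum_congr rfl fun d _ => ?_
  rw [map_smul, smul_smul, BorderApolarityToricFixedPoints.tli_prod_zpow_pow_eq b hb w d,
    zpow_sub₀ hb, zpow_neg, div_eq_mul_inv]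
  ring

/-- **Coefficientwise limit of the rescaled toric family.** If `e₀` bounds the weights
`⟨w,d⟩` of the monomials of `F`, then `(t+2)^{-e₀} • A·(diag((t+2)^w)·F) → A·F₀` coefficientwise,
where `F₀ = Σ_{⟨w,d⟩ = e₀} F_d x^d` is the top weight component. [folklore] -/
theorem tendsto_coeffVec_torus (A : Matrix σ σ ℂ) (F : MvPolynomial σ ℂ) (w : σ → ℤ) {e₀ : ℤ}
    (hmax : ∀ d ∈ F.support, Finsupp.weight w d ≤ e₀) :
    Tendsto (fun t : ℕ => coeffVec ((((t : ℂ) + 2) ^ (-e₀)) •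
        linSubst σ ℂ A (linSubst σ ℂ (Matrix.diagonal fun i => ((t : ℂ) + 2) ^ (w i)) F))) atTop
      (𝓝 (coeffVec (linSubst σ ℂ A (∑ d ∈ F.support,
          monomial d (if Finsupp.weight w d = e₀ then coeff d F else 0))))) := by
  have key : ∀ t : ℕ, (((t : ℂ) + 2) ^ (-e₀)) •
      linSubst σ ℂ A (linSubst σ ℂ (Matrix.diagonal fun i => ((t : ℂ) + 2) ^ (w i)) F) =
      ∑ d ∈ F.support, (((t : ℂ) + 2) ^ (Finsupp.weight w d - e₀) * coeff d F) •
        linSubst σ ℂ A (monomial d (1 : ℂ)) :=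
    fun t => smul_linSubst_torus A F w e₀
      (BorderApolarityToricFixedPoints.tli_natCast_add_two_ne_zero t)
  have h2 : linSubst σ ℂ A (∑ d ∈ F.support,
      monomial d (if Finsupp.weight w d = e₀ then coeff d F else 0)) =
      ∑ d ∈ F.support, (if Finsupp.weight w d = e₀ then coeff d F else 0) •
        linSubst σ ℂ A (monomial d (1 : ℂ)) := by
    rw [map_sum]
    refine Finset.sum_congr rfl fun d _ => ?_
    rw [← map_smul, smul_monomial, smul_eq_mul, mul_one]
  simp_rw [key]
  rw [h2]
  exact tendsto_coeffVec_sum_smul _ _ fun d hd => tendsto_zpow_sub_mul (hmax d hd) (coeff d F)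

/-- **Annihilators of a limit direction are border annihilators.** If the `Q t` are forms of
degree `j`, `r t • Q t → Q_∞ ≠ 0` coefficientwise with `r t ≠ 0`, and `J j` contains every
subsequential coefficientwise limit of degree-`j` annihilators of the `Q t` (the limsup clause W3),
then every degree-`j` form apolar to `Q_∞` lies in `J j`. [folklore] -/
theorem mem_of_apolarAction_limit_eq_zero {j : ℕ} {Q : ℕ → MvPolynomial σ ℂ}
    {J : ℕ → Set (MvPolynomial σ ℂ)} (hQhom : ∀ t, (Q t).IsHomogeneous j)
    (hW3 : ∀ (D : MvPolynomial σ ℂ) (φ : ℕ → ℕ) (Ds : ℕ → MvPolynomial σ ℂ), StrictMono φ →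
      (∀ t, (Ds t).IsHomogeneous j ∧ apolarAction (Ds t) (Q (φ t)) = 0) →
      Tendsto (fun t => coeffVec (Ds t)) atTop (𝓝 (coeffVec D)) → D ∈ J j)
    {r : ℕ → ℂ} (hr : ∀ t, r t ≠ 0) {Qinf : MvPolynomial σ ℂ} (hQinfhom : Qinf.IsHomogeneous j)
    (hQinfne : Qinf ≠ 0)
    (hlim : Tendsto (fun t => coeffVec (r t • Q t)) atTop (𝓝 (coeffVec Qinf)))
    {D : MvPolynomial σ ℂ} (hD : D.IsHomogeneous j) (hDQ : apolarAction D Qinf = 0) :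
    D ∈ J j := by
  have hwv : ∀ t, (fun d : ((Finset.univ : Finset σ).finsuppAntidiag j) =>
      coeff d.1 (Q t) * ∏ i ∈ d.1.support, ((d.1 i).factorial : ℂ)) =
      (r t)⁻¹ • fun d : ((Finset.univ : Finset σ).finsuppAntidiag j) =>
        coeff d.1 (r t • Q t) * ∏ i ∈ d.1.support, ((d.1 i).factorial : ℂ) := by
    intro t
    funext d
    simp only [Pi.smul_apply, smul_eq_mul]
    rw [coeff_smul, smul_eq_mul, ← mul_assoc, ← mul_assoc, inv_mul_cancel₀ (hr t), one_mul]
  have hlimv : Tendsto (fun t => fun d : ((Finset.univ : Finset σ).finsuppAntidiag j) =>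
      coeff d.1 (r t • Q t) * ∏ i ∈ d.1.support, ((d.1 i).factorial : ℂ)) atTop
      (𝓝 fun d => coeff d.1 Qinf * ∏ i ∈ d.1.support, ((d.1 i).factorial : ℂ)) :=
    tendsto_pi_nhds.2 fun d => (tendsto_pi_nhds.1 hlim d.1).mul_const _
  have hLD : (∑ d : ((Finset.univ : Finset σ).finsuppAntidiag j),
      coeff d.1 D * (coeff d.1 Qinf * ∏ i ∈ d.1.support, ((d.1 i).factorial : ℂ))) = 0 := by
    rwa [BorderApolarity.apolarAction_eq_zero_iff_sum hD hQinfhom] at hDQ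
  exact BorderApolarity.mem_of_sum_eq_zero hQhom hW3 _ (fun t => (r t)⁻¹) hwv
    (BorderApolarity.weightedCoeff_ne_zero hQinfhom hQinfne) strictMono_id hlimv hD hLD

/-- **Two hyperplanes of `S_j` in containment have proportional normals.** If every degree-`j`
form apolar to the form `P ≠ 0` of degree `j` is apolar to the form `R` of degree `j`, then
`R = μ • P` (top-degree pairing `D ⌟ g = Σ_d D_d g_d d!`). [folklore] -/
theorem exists_eq_smul_of_apolar_imp {j : ℕ} {P R : MvPolynomial σ ℂ} (hP : P.IsHomogeneous j)
    (hPne : P ≠ 0) (hR : R.IsHomogeneous j)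
    (h : ∀ D : MvPolynomial σ ℂ, D.IsHomogeneous j → apolarAction D P = 0 → apolarAction D R = 0) :
    ∃ μ : ℂ, R = μ • P := by
  have himp : ∀ c : ((Finset.univ : Finset σ).finsuppAntidiag j) → ℂ,
      (∑ d, c d * (coeff d.1 P * ∏ i ∈ d.1.support, ((d.1 i).factorial : ℂ))) = 0 →
      (∑ d, c d * (coeff d.1 R * ∏ i ∈ d.1.support, ((d.1 i).factorial : ℂ))) = 0 := by
    intro c hc
    have hhom := BorderApolarity.isHomogeneous_sum_monomial (σ := σ) (j := j) c
    have h1 : apolarAction (∑ e : ((Finset.univ : Finset σ).finsuppAntidiag j),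
        monomial e.1 (c e)) P = 0 := by
      rw [BorderApolarity.apolarAction_eq_zero_iff_sum hhom hP]
      simpa only [BorderApolarity.coeff_sum_monomial] using hc
    have h2 := h _ hhom h1
    rw [BorderApolarity.apolarAction_eq_zero_iff_sum hhom hR] at h2
    simpa only [BorderApolarity.coeff_sum_monomial] using h2
  obtain ⟨μ, hμ⟩ := BorderApolarity.exists_smul_of_sum_eq_zero_imp _ _
    (BorderApolarity.weightedCoeff_ne_zero hP hPne) himp
  refine ⟨μ, ?_⟩
  ext x
  rw [coeff_smul, smul_eq_mul]
  by_cases hx : x.degree = j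
  · have hμx := congrFun hμ ⟨x, BorderApolarity.mem_finsuppAntidiag_univ_iff.2 hx⟩
    simp only [Pi.smul_apply, smul_eq_mul] at hμx
    exact mul_right_cancel₀ (BorderApolarity.prod_factorial_ne_zero x)
      (hμx.trans (mul_assoc _ _ _).symm)
  · rw [hR.coeff_eq_zero hx, hP.coeff_eq_zero hx, mul_zero]

end Torus

/-- **The socle step** (`apolarAction` form).  For `n ≤ m`, let
`Q t = u · diag((t+2)^w) · g · det_m` be a toric family (`w : variables → ℤ`).  If `J m` contains
every subsequential coefficientwise limit of degree-`m` annihilators of the `Q t` (W3 at `k = m`)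
and `J m ⌟ pp = 0` (W5 at `k = m`), then `pp = u · wHC_{w'}^{e'}(g' · det_m)` with ℕ-valued
weights `w'`. [folklore] -/
theorem exists_eq_weightedHomogeneousComponent {n m : ℕ} [NeZero m] (hnm : n ≤ m)
    (J : ℕ → Set (MvPolynomial (Fin m × Fin m) ℂ))
    (u g : Matrix.GeneralLinearGroup (Fin m × Fin m) ℂ) (w : Fin m × Fin m → ℤ)
    (Q : ℕ → MvPolynomial (Fin m × Fin m) ℂ)
    (hQ : ∀ t : ℕ, Q t = linSubst (Fin m × Fin m) ℂ (u : Matrix (Fin m × Fin m) (Fin m × Fin m) ℂ)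
      (linSubst (Fin m × Fin m) ℂ (Matrix.diagonal fun i : Fin m × Fin m => ((t : ℂ) + 2) ^ (w i))
        (linSubst (Fin m × Fin m) ℂ (g : Matrix (Fin m × Fin m) (Fin m × Fin m) ℂ)
          (detPoly (Fin m) ℂ))))
    (hW3 : ∀ (D : MvPolynomial (Fin m × Fin m) ℂ) (φ : ℕ → ℕ)
      (Ds : ℕ → MvPolynomial (Fin m × Fin m) ℂ), StrictMono φ →
      (∀ t, (Ds t).IsHomogeneous m ∧ apolarAction (Ds t) (Q (φ t)) = 0) →
      Tendsto (fun t => coeffVec (Ds t)) atTop (𝓝 (coeffVec D)) → D ∈ J m)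
    (hW5 : ∀ D ∈ J m, apolarAction D (paddedPerPoly ℂ n m) = 0) :
    ∃ (u' g' : Matrix.GeneralLinearGroup (Fin m × Fin m) ℂ) (w' : Fin m × Fin m → ℕ) (e : ℕ),
      paddedPerPoly ℂ n m =
        linSubst (Fin m × Fin m) ℂ (u' : Matrix (Fin m × Fin m) (Fin m × Fin m) ℂ)
          (MvPolynomial.weightedHomogeneousComponent w' e
            (linSubst (Fin m × Fin m) ℂ (g' : Matrix (Fin m × Fin m) (Fin m × Fin m) ℂ)
              (detPoly (Fin m) ℂ))) := by
  -- `F = g · det_m`: a nonzero form of degree `m` in the orbit of `det_m`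
  set F : MvPolynomial (Fin m × Fin m) ℂ := linSubst (Fin m × Fin m) ℂ
    (g : Matrix (Fin m × Fin m) (Fin m × Fin m) ℂ) (detPoly (Fin m) ℂ) with hF
  have hForb : F ∈ glOrbit (Fin m × Fin m) ℂ (detPoly (Fin m) ℂ) := ⟨g, linSubstRep_apply _ _ g _⟩
  have hFne : F ≠ 0 := BorderApolarity.ne_zero_of_mem_glOrbit_detPoly hForb
  have hFhom : F.IsHomogeneous m := by
    simpa [Fintype.card_fin] using BorderApolarity.isHomogeneous_of_mem_glOrbit_detPoly hForb
  have hdeg : ∀ d ∈ F.support, ∑ i ∈ d.support, (d i : ℤ) = m := fun d hd => by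
    have h : d.degree = m := by
      rw [Finsupp.degree_eq_weight_one]; exact hFhom (mem_support_iff.1 hd)
    rw [Finsupp.degree_apply] at h
    exact_mod_cast h
  -- the top weight `e₀` and the top weight component `F₀ ≠ 0` of `F`
  obtain ⟨d₀, hd₀, hmax⟩ := Finset.exists_max_image F.support (Finsupp.weight w)
    (support_nonempty.2 hFne)
  set e₀ : ℤ := Finsupp.weight w d₀ with he₀
  set F₀ : MvPolynomial (Fin m × Fin m) ℂ := ∑ d ∈ F.support,
    monomial d (if Finsupp.weight w d = e₀ then coeff d F else 0) with hF₀
  have hF₀coeff : ∀ d, coeff d F₀ =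
      if Finsupp.weight w d = e₀ then coeff d F else 0 := by
    intro d
    rw [hF₀, coeff_sum, Finset.sum_eq_single d (fun e _ hne => by rw [coeff_monomial, if_neg hne])
      (fun hd => by rw [coeff_monomial, if_pos rfl, notMem_support_iff.1 hd, ite_self]),
      coeff_monomial, if_pos rfl]
  have hF₀ne : F₀ ≠ 0 := by
    intro h
    have h0 := hF₀coeff d₀
    rw [h, coeff_zero, if_pos rfl] at h0
    exact (mem_support_iff.1 hd₀) h0.symm
  have hF₀hom : F₀.IsHomogeneous m := by
    intro d hd
    rw [hF₀coeff] at hd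
    split_ifs at hd with h
    · exact hFhom hd
    · exact absurd rfl hd
  -- the limit direction `Q_∞ = u · F₀ ≠ 0`, a form of degree `m`
  have hQinfne : linSubst (Fin m × Fin m) ℂ (u : Matrix (Fin m × Fin m) (Fin m × Fin m) ℂ) F₀ ≠ 0 :=
    fun h => hF₀ne (linSubst_injective_of_isUnit_det _ (Matrix.isUnits_det_units u)
      (h.trans (map_zero _).symm))
  have hQinfhom : (linSubst (Fin m × Fin m) ℂ (u : Matrix (Fin m × Fin m) (Fin m × Fin m) ℂ)
      F₀).IsHomogeneous m := linSubst_isHomogeneous _ hF₀hom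
  have hQhom : ∀ t, (Q t).IsHomogeneous m := fun t => by
    rw [hQ]; exact linSubst_isHomogeneous _ (linSubst_isHomogeneous _ hFhom)
  -- `(t+2)^{-e₀} • Q t → Q_∞` coefficientwise
  have hlim : Tendsto (fun t : ℕ => coeffVec ((((t : ℂ) + 2) ^ (-e₀)) • Q t)) atTop
      (𝓝 (coeffVec (linSubst (Fin m × Fin m) ℂ
        (u : Matrix (Fin m × Fin m) (Fin m × Fin m) ℂ) F₀))) := by
    simp_rw [hQ]
    exact tendsto_coeffVec_torus _ F w hmax
  -- `Ann_m(Q_∞) ⊆ J m ⊆ Ann_m(pp)`, so `pp = μ • Q_∞` with `μ ≠ 0`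
  have key : ∀ D : MvPolynomial (Fin m × Fin m) ℂ, D.IsHomogeneous m →
      apolarAction D (linSubst (Fin m × Fin m) ℂ
        (u : Matrix (Fin m × Fin m) (Fin m × Fin m) ℂ) F₀) = 0 → D ∈ J m :=
    fun D hD hDQ => mem_of_apolarAction_limit_eq_zero hQhom hW3
      (r := fun t : ℕ => ((t : ℂ) + 2) ^ (-e₀))
      (fun t => zpow_ne_zero _ (BorderApolarityToricFixedPoints.tli_natCast_add_two_ne_zero t))
      hQinfhom hQinfne hlim hD hDQ
  obtain ⟨μ, hμ⟩ := exists_eq_smul_of_apolar_imp hQinfhom hQinfne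
    (paddedPerPoly_isHomogeneous (k := ℂ) hnm) fun D hD hDQ => hW5 D (key D hD hDQ)
  have hμne : μ ≠ 0 := by
    rintro rfl
    rw [zero_smul] at hμ
    exact BorderApolarity.paddedPerPoly_ne_zero n m hμ
  -- repackage: `μ • F = g' · det_m`, and shift the weights to `ℕ`
  obtain ⟨g', hg'⟩ := BorderApolarity.smul_mem_glOrbit_detPoly hForb hμne
  have hg'' : linSubstRep (Fin m × Fin m) ℂ g' (detPoly (Fin m) ℂ) = μ • F := hg'
  rw [linSubstRep_apply] at hg''
  obtain ⟨i₀, -, hi₀⟩ := Finset.exists_min_image (Finset.univ : Finset (Fin m × Fin m)) w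
    Finset.univ_nonempty
  have hw' : ∀ i, (((w i - w i₀).toNat : ℕ) : ℤ) = w i - w i₀ := fun i =>
    Int.toNat_of_nonneg (sub_nonneg.2 (hi₀ i (Finset.mem_univ i)))
  have he₀ge : (m : ℤ) * w i₀ ≤ e₀ := by
    rw [he₀, Finsupp.weight_apply, Finsupp.sum]
    calc (m : ℤ) * w i₀ = ∑ i ∈ d₀.support, (d₀ i : ℤ) * w i₀ := by
          rw [← Finset.sum_mul, hdeg d₀ hd₀]
      _ ≤ ∑ i ∈ d₀.support, d₀ i • w i := Finset.sum_le_sum fun i _ => by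
          rw [nsmul_eq_mul]
          exact mul_le_mul_of_nonneg_left (hi₀ i (Finset.mem_univ i)) (Nat.cast_nonneg _)
  have he' : (((e₀ - m * w i₀).toNat : ℕ) : ℤ) = e₀ - m * w i₀ :=
    Int.toNat_of_nonneg (sub_nonneg.2 he₀ge)
  have hwhc : weightedHomogeneousComponent (fun i => (w i - w i₀).toNat) (e₀ - m * w i₀).toNat F =
      F₀ := by
    ext d
    rw [coeff_weightedHomogeneousComponent, hF₀coeff]
    by_cases hd : d ∈ F.support
    · have hwt : ((Finsupp.weight (fun i => (w i - w i₀).toNat) d : ℕ) : ℤ) =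
          Finsupp.weight w d - m * w i₀ := by
        rw [Finsupp.weight_apply, Finsupp.weight_apply, Finsupp.sum, Finsupp.sum]
        simp only [smul_eq_mul, nsmul_eq_mul, Nat.cast_sum, Nat.cast_mul, hw']
        rw [← hdeg d hd, Finset.sum_mul, ← Finset.sum_sub_distrib]
        exact Finset.sum_congr rfl fun i _ => by ring
      have hiff : Finsupp.weight (fun i => (w i - w i₀).toNat) d = (e₀ - m * w i₀).toNat ↔
          Finsupp.weight w d = e₀ := by
        rw [← Nat.cast_inj (R := ℤ), hwt, he', sub_left_inj]
      by_cases h : Finsupp.weight w d = e₀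
      · rw [if_pos h, if_pos (hiff.2 h)]
      · rw [if_neg h, if_neg (mt hiff.1 h)]
    · rw [notMem_support_iff.1 hd, ite_self, ite_self]
  refine ⟨u, g', fun i => (w i - w i₀).toNat, (e₀ - m * w i₀).toNat, ?_⟩
  rw [hg'', map_smul, map_smul, hwhc]
  exact hμ

end

end Socle

/-- **Stub 1b — the SOCLE STEP** of line `toric-face-debordering` (crux `FixedWitnessObstructionQP`,
stmt-ValiantsHypothesis-5778).  If `J` is the border-apolar limit (W2 ∧ W3, `k ≤ m`) of the TORIC
family `Q_t = u · diag((t+2)^w) · g · det_m` (`w : variables → ℤ`; the conclusion of route item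
`ToricFixedPoints`, stmt-5779, verbatim) and `J_k ⊆ Ann_k(pp)` for `k ≤ m` (W5), then the
padded permanent `pp = X₀₀^{m-n} per_n` is a translate of a weighted-homogeneous component of a
translate of the determinant, with ℕ-valued weights.  Only W3 and W5 at `k = m` are used
(`Socle.exists_eq_weightedHomogeneousComponent`; the inline `act` is `apolarAction` by `rfl`).
Sources: Buczyńska–Buczyński 2021 Thm 1 (necessity half, socle degree); Landsberg 2017 §6.7.
[folklore] -/
theorem stub_socle : ∀ (n m : ℕ) [NeZero m], 3 ≤ n → n ≤ m → let act := fun (D f : MvPolynomial (Fin m × Fin m) ℂ) => ∑ e ∈ D.support, ∑ d ∈ f.support, MvPolynomial.monomial (d - e) (MvPolynomial.coeff e D * MvPolynomial.coeff d f * ∏ i ∈ e.support, (Nat.descFactorial (d i) (e i) : ℂ));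
    ∀ (J : ℕ → Set (MvPolynomial (Fin m × Fin m) ℂ)) (u g : Matrix.GeneralLinearGroup (Fin m × Fin m) ℂ)
      (w : Fin m × Fin m → ℤ),
      (let Q : ℕ → MvPolynomial (Fin m × Fin m) ℂ := fun t => Literature.Computability.AlgebraicComplexity.linSubst (Fin m × Fin m) ℂ (u : Matrix (Fin m × Fin m) (Fin m × Fin m) ℂ) (Literature.Computability.AlgebraicComplexity.linSubst (Fin m × Fin m) ℂ (Matrix.diagonal fun i : Fin m × Fin m => ((t : ℂ) + 2) ^ (w i)) (Literature.Computability.AlgebraicComplexity.linSubst (Fin m × Fin m) ℂ (g : Matrix (Fin m × Fin m) (Fin m × Fin m) ℂ) (Literature.Computability.AlgebraicComplexity.detPoly (Fin m) ℂ))); (∀ k ≤ m, ∀ D ∈ J k, ∃ Ds : ℕ → MvPolynomial (Fin m × Fin m) ℂ, (∀ t, (Ds t).IsHomogeneous k ∧ act (Ds t) (Q t) = 0) ∧ Filter.Tendsto (fun t => Literature.Computability.AlgebraicComplexity.coeffVec (Ds t)) Filter.atTop (nhds (Literature.Computability.AlgebraicComplexity.coeffVec D))) ∧ (∀ k ≤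 m, ∀ (D : MvPolynomial (Fin m × Fin m) ℂ) (φ : ℕ → ℕ) (Ds : ℕ → MvPolynomial (Fin m × Fin m) ℂ), StrictMono φ → (∀ t, (Ds t).IsHomogeneous k ∧ act (Ds t) (Q (φ t)) = 0) → Filter.Tendsto (fun t => Literature.Computability.AlgebraicComplexity.coeffVec (Ds t)) Filter.atTop (nhds (Literature.Computability.AlgebraicComplexity.coeffVec D)) → D ∈ J k)) →
      (∀ k ≤ m, ∀ D ∈ J k, act D (Literature.Computability.AlgebraicComplexity.paddedPerPoly ℂ n m) = 0) →
      ∃ (u g : Matrix.GeneralLinearGroup (Fin m × Fin m) ℂ) (w : Fin m × Fin m → ℕ) (e : ℕ),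
        paddedPerPoly ℂ n m =
          linSubst (Fin m × Fin m) ℂ (u : Matrix (Fin m × Fin m) (Fin m × Fin m) ℂ)
            (MvPolynomial.weightedHomogeneousComponent w e
              (linSubst (Fin m × Fin m) ℂ (g : Matrix (Fin m × Fin m) (Fin m × Fin m) ℂ) (detPoly (Fin m) ℂ))) := by
  intro n m _ _ hnm
  dsimp only
  intro J u g w hQ hW5
  exact Socle.exists_eq_weightedHomogeneousComponent hnm J u g w _ (fun t => rfl) (hQ.2 m le_rfl)
    (hW5 m le_rfl)

end Summit.ValiantsHypothesis.ValiantsHypothesis.Theorems.BorderApolarityFixedWitnessObstructionQP
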